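import Literature.Geometry.PolyhedralFans.LinkedRefinementStep
import Literature.Geometry.PolyhedralFans.FamilyDescent
import Literature.Geometry.PolyhedralFans.BarycentricSubdivision
import Literature.Geometry.PolyhedralFans.LinkOrbits
import HarnessLib

/-!
# Regular projective subdivision of a linked family of fans — proof of
# `Fan.LinkedRegularRefinementFamily` (KKMS 1973, Ch. II §2 Thm. 11*, by charts)

Topic: `Literature/Geometry/PolyhedralFans` (block A5, the assembly of the LINKED-KKMS programme;
summit `ResolutionOfSingularities`, W8.1: with `LogRegularResolutionGeneral.lean` this yields the
atlas form of K. Kato, *Toric singularities* (1994), (10.4)). G. Kempf, F. Knudsen, D. Mumford,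
B. Saint-Donat, *Toroidal Embeddings I*, Ch. II §2: the regular projective subdivision of a
conical polyhedral complex with integral structure, here a family of rational fans
`Δ₀ i ⊆ ℚ^{n i}` with LINKS (lattice isomorphisms between cones of the members, `Fan.FamilyLink`).
The proof runs the synchronised procedure assembled from the tree:

1. **Barycentric subdivision, synchronised** (`sd_phase`): star every member at the barycentres
   of its cones by decreasing dimension (res-type-037 `BarycentricSubdivision`: stage cones,
   stage separation), one multi-point Lemma-2 step per dimension with ONE constant for the whole
   family (`Fan.family_step`, using res-type-037's multi-point Lemma 2 and res-lit-3's transport /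
   bridge): afterwards every member is the flag fan of its base fan (simplicial, primitively
   simplicial), the order functions are link-compatible in cones and values.
2. **Multiplicity descent, synchronised** (`descent_phase`): while some member is not regular,
   take a cone of globally maximal count, a primitive parallelotope point, its ORBIT under the
   links (res-type-037 `Fan.exists_orbit`: finite, link-closed, parallelotope points member by
   member, separated because orbit points have flag representations with the same coefficients),
   and perform `Fan.family_step` at the orbit; the family measure drops
   (`Fan.exists_regular_family_of_invariant`, `FamilyDescent`).
3. **Packaging** (`Fan.linkedRegularRefinementFamily_holds`): one rational constant makes all
   pieces integral, tight and non-negative (`Fan.family_tight_packaging`), preserving value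
   compatibility.

References: [KempfEtAl1973] Ch. I §2 Thm. 11, Ch. II §1 Def. 5, §2 Thm. 11*; [Fulton1993Toric]
§2.6; [Ewald1996] VI Thm. 8.5; [Kato1994] (9.8), (10.4).
-/

noncomputable section

namespace Literature.Geometry.PolyhedralFans

open PointedCone Finset

namespace Fan

variable {κ : Type*} [Fintype κ]

/-! ## Helpers -/

/-- The flag fan (stage `0` of the barycentric subdivision) is PRIMITIVELY simplicial: rescale
each barycentre to the first lattice point of its ray. [cite: KempfEtAl1973, Ch. II §2] -/
theorem isPrimSimplicial_of_dimZero {Δ : Fan ℚ (κ → ℚ)} (hΔ : Δ.IsRational) {Γ : Fan ℚ (κ → ℚ)}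
    (hΓ : Γ.cones = Δ.stageCones
      {φ | φ ∈ Δ.cones ∧ 0 < Module.finrank ℚ (Submodule.span ℚ (φ : Set (κ → ℚ)))}) :
    Γ.IsPrimSimplicial := by
  classical
  intro σ hσ
  rw [hΓ] at hσ
  have hne : Δ.cones.Nonempty := by
    obtain ⟨ρ, hρ, -⟩ := hσ
    exact ⟨ρ, hρ⟩
  obtain ⟨Φ, hΦ, h0, hch, rfl⟩ := (stageCones_dimZero_iff hne).mp hσ
  -- the barycentres: linearly independent nonzero lattice vectors
  have hli : LinearIndepOn ℚ id (bary '' (Φ : Set (PointedCone ℚ (κ → ℚ)))) :=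
    linearIndepOn_bary_of_isChain hΔ Φ hΦ h0 hch
  set S : Finset (κ → ℚ) := Φ.image bary with hS
  have hScoe : (S : Set (κ → ℚ)) = bary '' (Φ : Set _) := by rw [hS, Finset.coe_image]
  have hSlat : ∀ s ∈ S, s ∈ latticeN κ := by
    intro s hs
    obtain ⟨φ, hφ, rfl⟩ := Finset.mem_image.mp hs
    exact bary_mem_latticeN (Δ.fg (hΦ (Finset.mem_coe.mpr hφ)))
  have hS0 : ∀ s ∈ S, s ≠ 0 := by
    intro s hs
    obtain ⟨φ, hφ, rfl⟩ := Finset.mem_image.mp hs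
    have hφΔ := hΦ (Finset.mem_coe.mpr hφ)
    exact bary_ne_zero (hΔ.isRationalCone hφΔ) (Δ.salient hφΔ) fun h => h0 (h ▸ hφ)
  -- rescale to primitive vectors
  choose c hc using fun s : κ → ℚ => fun (hs : s ∈ S) => exists_isPrimitive_smul (hSlat s hs) (hS0 s hs)
  let c' : (κ → ℚ) → ℚ := fun s => if hs : s ∈ S then c s hs else 1
  have hc'pos : ∀ s ∈ S, 0 < c' s := fun s hs => by simp only [c', dif_pos hs]; exact (hc s hs).1
  have hc'prim : ∀ s ∈ S, IsPrimitive (c' s • s) := fun s hs => by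
    simp only [c', dif_pos hs]; exact (hc s hs).2.2
  refine ⟨S.image fun s => c' s • s, ?_, ?_, ?_⟩
  · intro p hp
    obtain ⟨s, hs, rfl⟩ := Finset.mem_image.mp (Finset.mem_coe.mp hp)
    exact hc'prim s hs
  · -- linear independence of the rescaled family
    have hli' : LinearIndepOn ℚ id (S : Set (κ → ℚ)) := by rw [hScoe]; exact hli
    have key := linearIndepOn_finset_iffₛ.mp hli'
    have hsingle : ∀ s ∈ S, ∀ (b : ℚ),
        ∑ x ∈ S, (fun x => if x = s then b else 0) x • id x = b • s := by
      intro s hs b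
      rw [Finset.sum_eq_single s (fun x _ hx => by simp [hx]) (fun h => absurd hs h)]
      simp
    -- injectivity of the rescaling on `S`
    have hinj : ∀ s ∈ S, ∀ s' ∈ S, c' s • s = c' s' • s' → s = s' := by
      intro s hs s' hs' h
      by_contra hne
      have heq := (hsingle s hs (c' s)).trans (h.trans (hsingle s' hs' (c' s')).symm)
      have := key _ _ heq s hs
      simp only [if_neg hne, ite_true] at this
      exact (hc'pos s hs).ne' this
    apply linearIndepOn_finset_iffₛ.mpr
    intro f g hfg t ht
    obtain ⟨s, hs, rfl⟩ := Finset.mem_image.mp ht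
    have hsum : ∀ φ : (κ → ℚ) → ℚ, ∑ t ∈ S.image (fun s => c' s • s), φ t • id t =
        ∑ s ∈ S, (φ (c' s • s) * c' s) • id s := by
      intro φ
      rw [Finset.sum_image (fun x hx y hy hxy => hinj x hx y hy hxy)]
      exact Finset.sum_congr rfl fun x _ => by simp only [id, smul_smul]
    rw [hsum f, hsum g] at hfg
    exact mul_right_cancel₀ (hc'pos s hs).ne' (key _ _ hfg s hs)
  · rw [hull_image_smul_eq S c' hc'pos, hScoe]; rfl

/-- A cone of count `≥ 2` in a primitively simplicial fan carries a PRIMITIVE nonzero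
parallelotope point (normalise a nonzero parallelotope point to the first lattice point of its
ray; extracted from res-type-037's `exists_parPoint_of_not_isRegular`). [cite: Ewald1996, VI Thm. 8.5] -/
theorem exists_parPoint_of_two_le_conePMult {Δ : Fan ℚ (κ → ℚ)} (hΔ : Δ.IsPrimSimplicial)
    {σ : PointedCone ℚ (κ → ℚ)} (hσ : σ ∈ Δ.cones) (h2 : 2 ≤ conePMult σ) :
    ∃ S : Finset (κ → ℚ), IsPrimGens σ S ∧
      ∃ a ∈ parCoeffs S, IsPrimitive (∑ s ∈ S, a s • s) ∧ (∑ s ∈ S, a s • s) ∈ σ := by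
  classical
  obtain ⟨S, hS⟩ := hΔ.exists_isPrimGens hσ
  have hSnr : ¬ IsRegularGens S := fun h => by
    have := pmult_eq_one_of_isRegularGens h
    rw [conePMult_eq hS] at h2
    omega
  obtain ⟨a, ha, j, hj, haj⟩ := exists_ne_zero_of_not_isRegularGens hS.mem_latticeN hS.2.1 hSnr
  set w₀ := ∑ s ∈ S, a s • s with hw₀
  have hw₀N : w₀ ∈ latticeN κ := ha.2.2
  have hw₀0 : w₀ ≠ 0 := by
    intro h0
    have hzero : ∑ s ∈ S, a s • s = ∑ s ∈ S, (0 : (κ → ℚ) → ℚ) s • s := by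
      rw [← hw₀, h0]; simp
    exact haj (eq_on_of_sum_smul_eq hS.2.1 hzero j hj)
  obtain ⟨c, hc0, hc1, hprim⟩ := exists_isPrimitive_smul hw₀N hw₀0
  let a' : (κ → ℚ) → ℚ := fun s => c * a s
  have hw : ∑ s ∈ S, a' s • s = c • w₀ := by
    rw [hw₀, Finset.smul_sum]
    exact Finset.sum_congr rfl fun s _ => by rw [smul_smul]
  have ha' : a' ∈ parCoeffs S := by
    refine ⟨fun s hs => ⟨mul_nonneg hc0.le (ha.1 s hs).1, ?_⟩, fun s hs => ?_, ?_⟩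
    · calc c * a s ≤ 1 * a s := mul_le_mul_of_nonneg_right hc1 (ha.1 s hs).1
        _ < 1 := by rw [one_mul]; exact (ha.1 s hs).2
    · simp only [a', ha.2.1 s hs, mul_zero]
    · rw [hw]; exact hprim.1
  refine ⟨S, hS, a', ha', hw ▸ hprim, ?_⟩
  rw [hS.2.2]
  exact sum_smul_mem_hull fun s hs => (ha'.1 s hs).1

/-- A primitively simplicial fan with a cone of count `≥ 2` is not regular... rather: a
primitively simplicial fan which is not regular has a cone of count `≥ 2`.
[cite: Ewald1996, VI Thm. 8.5] -/
theorem exists_two_le_conePMult_of_not_isRegular {Δ : Fan ℚ (κ → ℚ)} (hΔ : Δ.IsPrimSimplicial)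
    (hnr : ¬ Δ.IsRegular) : ∃ ρ ∈ Δ.cones, 2 ≤ conePMult ρ := by
  classical
  obtain ⟨ρ, hρ, hρnr⟩ : ∃ ρ ∈ Δ.cones, ∀ S : Finset (κ → ℚ), IsPrimGens ρ S → ¬ IsRegularGens S := by
    by_contra hne
    push Not at hne
    apply hnr
    intro ρ hρ
    obtain ⟨S, hS, hreg⟩ := hne ρ hρ
    exact ⟨S, hreg, hS.2.2⟩
  obtain ⟨Sρ, hSρ⟩ := hΔ.exists_isPrimGens hρ
  refine ⟨ρ, hρ, ?_⟩
  have h1 : pmult Sρ ≠ 1 := fun h =>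
    hρnr Sρ hSρ (isRegularGens_of_pmult_eq_one hSρ.mem_latticeN hSρ.2.1 h)
  have h2 : 0 < pmult Sρ := pmult_pos hSρ.2.1
  rw [conePMult_eq hSρ]
  omega

/-! ## The family: base compatibility and the barycentric phase -/

section Family

variable {ι : Type} [Fintype ι] {n : ι → ℕ}

omit [Fintype ι] in
/-- The base family is compatible with each of its links (faces of the source go to faces of the
target). [cite: KempfEtAl1973, Ch. II §1 Def. 5] -/
theorem familyLinkCompatible_base {Δ₀ : ∀ i, Fan ℚ (Fin (n i) → ℚ)} (ℓ : FamilyLink n Δ₀) :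
    FamilyLinkCompatible Δ₀ ℓ := by
  intro ρ hρ
  refine ⟨ℓ.map_mem_cones_of_le hρ.1 hρ.2, ?_⟩
  intro y hy
  obtain ⟨x, hx, rfl⟩ := PointedCone.mem_map.mp hy
  exact ℓ.mapsTo x (hρ.2 hx)

/-- **Phase 1 — synchronised barycentric subdivision of a linked family** ([KempfEtAl1973] II
§2): star every member at the barycentres of its cones by decreasing dimension, one multi-point
step per dimension with one constant for the family; the result is the FLAG FAN of every member,
with non-negative order functions compatible with every link in cones and values.
[cite: KempfEtAl1973, Ch. II §2 Thm. 11*] -/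
theorem sd_phase (Δ₀ : ∀ i, Fan ℚ (Fin (n i) → ℚ)) (hΔ₀ : ∀ i, (Δ₀ i).IsRational)
    (L : Set (FamilyLink n Δ₀)) :
    ∃ (l : ∀ i, List (Fin (n i) → ℚ)) (f : ∀ i, (Fin (n i) → ℚ) → ℚ),
      (∀ i, ∀ w ∈ l i, w ∈ latticeN (Fin (n i)) ∧ w ≠ 0) ∧
      (∀ i, ∀ w ∈ l i, w ∈ (Δ₀ i).support) ∧
      (∀ i, IsOrdFunction (Δ₀ i) ((Δ₀ i).starIter (l i)) (f i)) ∧ (∀ i x, 0 ≤ f i x) ∧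
      (∀ ℓ ∈ L, FamilyLinkCompatible (fun k => (Δ₀ k).starIter (l k)) ℓ ∧
        FamilyLinkCompatible (fun k => (Δ₀ k).starIter (l k)) ℓ.symm ∧
        ∀ x ∈ ℓ.src, f ℓ.j (ℓ.toLin x) = f ℓ.i x) ∧
      ∀ i, ((Δ₀ i).starIter (l i)).cones = (Δ₀ i).stageCones
        {φ | φ ∈ (Δ₀ i).cones ∧ 0 < Module.finrank ℚ (Submodule.span ℚ (φ : Set (Fin (n i) → ℚ)))} := by
  classical
  -- the statement at stage `d`
  set D : ℕ := Finset.univ.sup n with hD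
  have hnD : ∀ i, n i ≤ D := fun i => Finset.le_sup (f := n) (Finset.mem_univ i)
  suffices main : ∀ m : ℕ, ∃ (l : ∀ i, List (Fin (n i) → ℚ)) (f : ∀ i, (Fin (n i) → ℚ) → ℚ),
      (∀ i, ∀ w ∈ l i, w ∈ latticeN (Fin (n i)) ∧ w ≠ 0) ∧
      (∀ i, ∀ w ∈ l i, w ∈ (Δ₀ i).support) ∧
      (∀ i, IsOrdFunction (Δ₀ i) ((Δ₀ i).starIter (l i)) (f i)) ∧ (∀ i x, 0 ≤ f i x) ∧
      (∀ ℓ ∈ L, FamilyLinkCompatible (fun k => (Δ₀ k).starIter (l k)) ℓ ∧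
        FamilyLinkCompatible (fun k => (Δ₀ k).starIter (l k)) ℓ.symm ∧
        ∀ x ∈ ℓ.src, f ℓ.j (ℓ.toLin x) = f ℓ.i x) ∧
      ∀ i, ((Δ₀ i).starIter (l i)).cones = (Δ₀ i).stageCones
        {φ | φ ∈ (Δ₀ i).cones ∧ D - m < Module.finrank ℚ (Submodule.span ℚ (φ : Set (Fin (n i) → ℚ)))} by
    obtain ⟨l, f, h1, h2, h3, h4, h5, h6⟩ := main D
    refine ⟨l, f, h1, h2, h3, h4, h5, fun i => ?_⟩
    rw [h6 i, Nat.sub_self]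
  intro m
  induction m with
  | zero =>
    refine ⟨fun _ => [], fun _ _ => 0, fun _ _ h => absurd h List.not_mem_nil,
      fun _ _ h => absurd h List.not_mem_nil, fun i => isOrdFunction_self_zero (Δ₀ i),
      fun _ _ => le_rfl, fun ℓ _ => ⟨familyLinkCompatible_base ℓ, familyLinkCompatible_base ℓ.symm,
        fun _ _ => rfl⟩, fun i => ?_⟩
    rw [Nat.sub_zero, starIter_nil, stageCones_dimTop]
    rw [Fintype.card_fin]; exact hnD i
  | succ m ih =>
    obtain ⟨l, f, hlat, hsupp, hord, hnn, hcompat, hcones⟩ := ih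
    by_cases hd : D - m = 0
    · -- nothing left to star
      refine ⟨l, f, hlat, hsupp, hord, hnn, hcompat, fun i => ?_⟩
      rw [hcones i, hd, show D - (m + 1) = 0 by omega]
    · -- star the cones of dimension `d = D - m ≥ 1`
      set d := D - m with hdd
      have hd1 : 1 ≤ d := Nat.one_le_iff_ne_zero.mpr hd
      let dimf : ∀ i, PointedCone ℚ (Fin (n i) → ℚ) → ℕ := fun i φ =>
        Module.finrank ℚ (Submodule.span ℚ (φ : Set (Fin (n i) → ℚ)))
      let C : ∀ i, Finset (PointedCone ℚ (Fin (n i) → ℚ)) := fun i =>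
        (Δ₀ i).finite.toFinset.filter fun φ => dimf i φ = d
      have hC : ∀ i φ, φ ∈ C i ↔ φ ∈ (Δ₀ i).cones ∧ dimf i φ = d := fun i φ => by
        simp only [C, Finset.mem_filter, Set.Finite.mem_toFinset]
      let Z : ∀ i, Finset (Fin (n i) → ℚ) := fun i => (C i).image bary
      let lZ : ∀ i, List (Fin (n i) → ℚ) := fun i => (C i).toList.map bary
      have hZmem : ∀ i z, z ∈ Z i ↔ ∃ φ ∈ (Δ₀ i).cones, dimf i φ = d ∧ bary φ = z := fun i z => by
        simp only [Z, Finset.mem_image, hC]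
        constructor
        · rintro ⟨φ, ⟨hφ, hdφ⟩, rfl⟩; exact ⟨φ, hφ, hdφ, rfl⟩
        · rintro ⟨φ, hφ, hdφ, rfl⟩; exact ⟨φ, ⟨hφ, hdφ⟩, rfl⟩
      have hne_bot : ∀ i φ, φ ∈ (Δ₀ i).cones → dimf i φ = d → φ ≠ ⊥ := by
        intro i φ _ hdφ hbot
        have : dimf i φ = 0 := by
          simp only [dimf, hbot]
          rw [Submodule.finrank_eq_zero, Submodule.span_eq_bot]
          intro x hx; exact (Submodule.mem_bot _).mp hx
        omega
      have hZ0 : ∀ i, ∀ z ∈ Z i, z ≠ 0 := by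
        intro i z hz
        obtain ⟨φ, hφ, hdφ, rfl⟩ := (hZmem i z).1 hz
        exact bary_ne_zero ((hΔ₀ i).isRationalCone hφ) ((Δ₀ i).salient hφ) (hne_bot i φ hφ hdφ)
      have hlZnd : ∀ i, (lZ i).Nodup := fun i =>
        (Finset.nodup_toList _).map_on fun φ hφ ψ hψ h =>
          bary_injOn (hΔ₀ i) ((hC i φ).1 (Finset.mem_toList.1 hφ)).1 ((hC i ψ).1 (Finset.mem_toList.1 hψ)).1 h
      have hlZ : ∀ i, ∀ z, z ∈ lZ i ↔ z ∈ Z i := fun i z => by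
        simp only [lZ, Z, List.mem_map, Finset.mem_toList, Finset.mem_image]
      -- separation in the current stage fans
      have hsep : ∀ i, ∀ σ ∈ ((Δ₀ i).starIter (l i)).cones, ∀ z ∈ Z i, ∀ z' ∈ Z i,
          z ∈ σ → z' ∈ σ → z = z' := by
        intro i σ hσ z hz z' hz' hzσ hz'σ
        obtain ⟨φ, hφ, hdφ, rfl⟩ := (hZmem i z).1 hz
        obtain ⟨φ', hφ', hdφ', rfl⟩ := (hZmem i z').1 hz'
        rw [dimStage_separated (hΔ₀ i) (hcones i) hφ hdφ hφ' hdφ' hσ hzσ hz'σ]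
      -- closure under the links (barycentres are link-equivariant)
      have hclosed1 : ∀ ℓ : FamilyLink n Δ₀, ∀ z ∈ Z ℓ.i, z ∈ ℓ.src → ℓ.toLin z ∈ Z ℓ.j := by
        intro ℓ z hz hzs
        obtain ⟨φ, hφ, hdφ, rfl⟩ := (hZmem ℓ.i z).1 hz
        have hle : φ ≤ ℓ.src := (bary_mem_iff (hΔ₀ ℓ.i) hφ ℓ.src_mem).1 hzs
        refine (hZmem ℓ.j _).2 ⟨φ.map ℓ.toLin, ℓ.map_mem_cones_of_le hφ hle, ?_, ℓ.bary_map hΔ₀ hφ hle⟩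
        simp only [dimf]
        rw [finrank_span_map_of_subset ℓ.eq_zero_of_toLin_eq_zero
          (fun x hx => Submodule.subset_span (hle hx))]
        exact hdφ
      have hclosed : ∀ ℓ ∈ L, (∀ z ∈ Z ℓ.i, z ∈ ℓ.src → ℓ.toLin z ∈ Z ℓ.j) ∧
          (∀ z ∈ Z ℓ.j, z ∈ ℓ.tgt → ℓ.invLin z ∈ Z ℓ.i) :=
        fun ℓ _ => ⟨hclosed1 ℓ, hclosed1 ℓ.symm⟩
      obtain ⟨M, hM, hord', hnn', hcompat'⟩ := family_step Δ₀ L l f hord hnn hcompat Z hZ0 hsep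
        hclosed lZ hlZnd hlZ
      refine ⟨fun i => l i ++ lZ i, _, fun i w hw => ?_, fun i w hw => ?_, hord', hnn', hcompat', fun i => ?_⟩
      · rcases List.mem_append.mp hw with hw | hw
        · exact hlat i w hw
        · obtain ⟨φ, hφ, -, rfl⟩ := (hZmem i w).1 ((hlZ i w).1 hw)
          exact ⟨bary_mem_latticeN ((Δ₀ i).fg hφ), hZ0 i _ ((hlZ i _).1 hw)⟩
      · rcases List.mem_append.mp hw with hw | hw
        · exact hsupp i w hw
        · obtain ⟨φ, hφ, -, rfl⟩ := (hZmem i w).1 ((hlZ i w).1 hw)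
          exact bary_mem_support hφ
      · rw [starIter_append]
        have hstage := starIter_dimStage (hΔ₀ i) hd1 (hcones i) (L := (C i).toList)
          (Finset.nodup_toList _) (fun φ => by rw [Finset.mem_toList, hC])
        rw [show D - (m + 1) = d - 1 by omega]
        exact hstage

/-! ## Phase 2: the synchronised multiplicity descent -/

/-- The invariant of the descent: the family is an iterated star subdivision of the base family
through nonzero lattice vectors of the supports, carries non-negative order functions compatible
with every link in cones and values, and every cone lies in a flag cone of the base.
[cite: KempfEtAl1973, Ch. II §2] -/
def DescentInv (Δ₀ : ∀ i, Fan ℚ (Fin (n i) → ℚ)) (L : Set (FamilyLink n Δ₀))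
    (Γ : ∀ i, Fan ℚ (Fin (n i) → ℚ)) : Prop :=
  ∃ l : ∀ i, List (Fin (n i) → ℚ), (∀ i, Γ i = (Δ₀ i).starIter (l i)) ∧
    (∀ i, ∀ w ∈ l i, w ∈ latticeN (Fin (n i)) ∧ w ≠ 0) ∧ (∀ i, ∀ w ∈ l i, w ∈ (Δ₀ i).support) ∧
    (∃ f : ∀ i, (Fin (n i) → ℚ) → ℚ, (∀ i, IsOrdFunction (Δ₀ i) (Γ i) (f i)) ∧ (∀ i x, 0 ≤ f i x) ∧
      ∀ ℓ ∈ L, FamilyLinkCompatible Γ ℓ ∧ FamilyLinkCompatible Γ ℓ.symm ∧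
        ∀ x ∈ ℓ.src, f ℓ.j (ℓ.toLin x) = f ℓ.i x) ∧
    ∀ i, ∀ κ ∈ (Γ i).cones, ∃ Ψ : Finset (PointedCone ℚ (Fin (n i) → ℚ)),
      (↑Ψ ⊆ (Δ₀ i).cones) ∧ ⊥ ∉ Ψ ∧ IsChain (· ≤ ·) (Ψ : Set (PointedCone ℚ (Fin (n i) → ℚ))) ∧
      κ ≤ flagCone (Ψ : Set (PointedCone ℚ (Fin (n i) → ℚ)))

/-- **The descent step for a linked family**: from a family satisfying the invariant,
primitively simplicial in every member and not regular in some member, the ORBIT of a primitive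
parallelotope point of a cone of globally maximal count (res-type-037 `Fan.exists_orbit`) is a
family of separated, link-closed lists of primitive parallelotope points, and the synchronised
step `Fan.family_step` re-establishes the invariant. [cite: KempfEtAl1973, Ch. II §2 Thm. 11*] -/
theorem descent_step (Δ₀ : ∀ i, Fan ℚ (Fin (n i) → ℚ)) (hΔ₀ : ∀ i, (Δ₀ i).IsRational)
    (L : Set (FamilyLink n Δ₀)) (Γ : ∀ i, Fan ℚ (Fin (n i) → ℚ)) (hI : DescentInv Δ₀ L Γ)
    (hps : ∀ i, (Γ i).IsPrimSimplicial) (hnr : ¬ ∀ i, (Γ i).IsRegular) :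
    ∃ l : ∀ i, List (Fin (n i) → ℚ), (∀ i, (l i).Nodup) ∧
      (∀ i, ∀ z ∈ l i, IsPrimitive z ∧ ∃ σ ∈ (Γ i).cones, ∃ S : Finset (Fin (n i) → ℚ),
        IsPrimGens σ S ∧ ∃ a ∈ parCoeffs S, z = ∑ s ∈ S, a s • s) ∧
      (∃ i₀, ∃ z ∈ l i₀, ∃ σ ∈ (Γ i₀).cones, conePMult σ = familyMaxPMult Γ ∧ z ∈ σ) ∧
      (∀ i, ∀ σ ∈ (Γ i).cones, ∀ z ∈ l i, ∀ z' ∈ l i, z ∈ σ → z' ∈ σ → z = z') ∧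
      DescentInv Δ₀ L (fun i => (Γ i).starIter (l i)) := by
  classical
  obtain ⟨l, hΓ, hlat, hsupp, ⟨f, hord, hnn, hcompat⟩, hflag⟩ := hI
  have hΓ' : Γ = fun i => (Δ₀ i).starIter (l i) := funext hΓ
  subst hΓ'
  -- a member and a cone of globally maximal count, and a primitive parallelotope point in it
  obtain ⟨i₁, hi₁⟩ : ∃ i, ¬ ((Δ₀ i).starIter (l i)).IsRegular := by
    by_contra h; push Not at h; exact hnr h
  obtain ⟨ρ₁, hρ₁, h2⟩ := exists_two_le_conePMult_of_not_isRegular (hps i₁) hi₁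
  set Γ : ∀ i, Fan ℚ (Fin (n i) → ℚ) := fun i => (Δ₀ i).starIter (l i) with hΓdef
  have hM2 : 2 ≤ familyMaxPMult Γ := h2.trans (conePMult_le_familyMaxPMult Γ hρ₁)
  obtain ⟨i₀, -, hi₀⟩ := Finset.exists_mem_eq_sup (Finset.univ : Finset ι) ⟨i₁, Finset.mem_univ _⟩
    fun i => (Γ i).maxPMult
  have hi₀M : (Γ i₀).maxPMult = familyMaxPMult Γ := hi₀.symm
  have hne₀ : (Γ i₀).finite.toFinset.Nonempty := by
    by_contra hem
    rw [Finset.not_nonempty_iff_eq_empty] at hem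
    have : (Γ i₀).maxPMult = 0 := by rw [maxPMult, hem, Finset.sup_empty]; rfl
    omega
  obtain ⟨ρ₀, hρ₀fin, hρ₀max⟩ := Finset.exists_mem_eq_sup _ hne₀ conePMult
  have hρ₀ : ρ₀ ∈ (Γ i₀).cones := (Γ i₀).finite.mem_toFinset.mp hρ₀fin
  have hρ₀M : conePMult ρ₀ = familyMaxPMult Γ := by rw [← hi₀M, maxPMult, hρ₀max]
  obtain ⟨S, hS, a, ha, hprim, hwρ₀⟩ := exists_parPoint_of_two_le_conePMult (hps i₀) hρ₀
    (by rw [hρ₀M]; exact hM2)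
  -- the orbit
  have hcover : ∀ i, ∀ σ ∈ (Δ₀ i).cones, (σ : Set (Fin (n i) → ℚ)) ⊆ ((Γ i).restrict σ).support := by
    intro i σ hσ
    obtain ⟨-, -, hsub⟩ := hord i hσ
    exact hsub
  obtain ⟨Z, hwZ, hZcl, hZpar, hZsep⟩ := exists_orbit Δ₀ hΔ₀ L Γ hflag hcover
    (fun ℓ hℓ => ⟨(hcompat ℓ hℓ).1, (hcompat ℓ hℓ).2.1⟩) hprim ⟨ρ₀, hρ₀, S, hS, a, ha, rfl⟩
  have hZ0 : ∀ i, ∀ z ∈ Z i, z ≠ 0 := fun i z hz => (hZpar i z hz).1.2.1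
  let lZ : ∀ i, List (Fin (n i) → ℚ) := fun i => (Z i).toList
  have hlZnd : ∀ i, (lZ i).Nodup := fun i => Finset.nodup_toList _
  have hlZ : ∀ i, ∀ z, z ∈ lZ i ↔ z ∈ Z i := fun i z => Finset.mem_toList
  -- the synchronised step
  obtain ⟨M, hM, hord', hnn', hcompat'⟩ := family_step Δ₀ L l f hord hnn hcompat Z hZ0 hZsep hZcl
    lZ hlZnd hlZ
  have hnew : (fun i => (Γ i).starIter (lZ i)) = fun i => (Δ₀ i).starIter (l i ++ lZ i) := by
    funext i; rw [starIter_append]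
  refine ⟨lZ, hlZnd, fun i z hz => hZpar i z ((hlZ i z).1 hz),
    ⟨i₀, _, (hlZ i₀ _).2 hwZ, ρ₀, hρ₀, hρ₀M, hwρ₀⟩,
    fun i σ hσ z hz z' hz' => hZsep i σ hσ z ((hlZ i z).1 hz) z' ((hlZ i z').1 hz'), ?_⟩
  refine ⟨fun i => l i ++ lZ i, fun i => by rw [starIter_append], fun i w hw => ?_, fun i w hw => ?_,
    ⟨_, fun i => ?_, hnn', ?_⟩, fun i κ' hκ' => ?_⟩
  · rcases List.mem_append.mp hw with hw | hw
    · exact hlat i w hw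
    · exact ⟨(hZpar i w ((hlZ i w).1 hw)).1.1, hZ0 i w ((hlZ i w).1 hw)⟩
  · rcases List.mem_append.mp hw with hw | hw
    · exact hsupp i w hw
    · obtain ⟨-, σ, hσ, S', hS', a', ha', hwa⟩ := hZpar i w ((hlZ i w).1 hw)
      have hwσ : w ∈ σ := by rw [hwa, hS'.2.2]; exact sum_smul_mem_hull fun s hs => (ha'.1 s hs).1
      have : w ∈ (Γ i).support := mem_support.mpr ⟨σ, hσ, hwσ⟩
      rwa [hΓdef, starIter_support_eq (l i) (fun z hz => (hlat i z hz).2)] at this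
  · have := hord' i
    rwa [starIter_append] at this
  · rw [hnew]; exact hcompat'
  · obtain ⟨κ, hκ, hle⟩ := starIter_exists_le (lZ i) hκ'
    obtain ⟨Ψ, hΨ, h0, hch, hκΨ⟩ := hflag i κ hκ
    exact ⟨Ψ, hΨ, h0, hch, hle.trans hκΨ⟩

/-- **Phase 2 — the descent**: from the flag fans of Phase 1, the family loop
`Fan.exists_regular_family_of_invariant` with `descent_step` reaches a family which is regular and
primitively simplicial in every member and still satisfies the invariant.
[cite: KempfEtAl1973, Ch. II §2 Thm. 11*] -/
theorem descent_phase (Δ₀ : ∀ i, Fan ℚ (Fin (n i) → ℚ)) (hΔ₀ : ∀ i, (Δ₀ i).IsRational)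
    (L : Set (FamilyLink n Δ₀)) :
    ∃ Γ : ∀ i, Fan ℚ (Fin (n i) → ℚ), (∀ i, (Γ i).IsRegular) ∧ (∀ i, (Γ i).IsPrimSimplicial) ∧
      DescentInv Δ₀ L Γ := by
  classical
  obtain ⟨l, f, hlat, hsupp, hord, hnn, hcompat, hcones⟩ := sd_phase Δ₀ hΔ₀ L
  set Γ₀ : ∀ i, Fan ℚ (Fin (n i) → ℚ) := fun i => (Δ₀ i).starIter (l i) with hΓ₀
  have hI₀ : DescentInv Δ₀ L Γ₀ := by
    refine ⟨l, fun i => rfl, hlat, hsupp, ⟨f, hord, hnn, hcompat⟩, fun i κ hκ => ?_⟩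
    have hκ' : κ ∈ (Δ₀ i).stageCones
        {φ | φ ∈ (Δ₀ i).cones ∧ 0 < Module.finrank ℚ (Submodule.span ℚ (φ : Set (Fin (n i) → ℚ)))} := by
      rw [← hcones i]; exact hκ
    have hne : (Δ₀ i).cones.Nonempty := by
      obtain ⟨ρ, hρ, -⟩ := hκ'
      exact ⟨ρ, hρ⟩
    obtain ⟨Ψ, hΨ, h0, hch, rfl⟩ := (stageCones_dimZero_iff hne).mp hκ'
    exact ⟨Ψ, hΨ, h0, hch, le_rfl⟩
  have hps₀ : ∀ i, (Γ₀ i).IsPrimSimplicial := fun i => isPrimSimplicial_of_dimZero (hΔ₀ i) (hcones i)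
  obtain ⟨Lst, -, -, hreg, hps, hI⟩ := exists_regular_family_of_invariant (I := DescentInv Δ₀ L)
    (fun Γ hI hps hnr => descent_step Δ₀ hΔ₀ L Γ hI hps hnr) hI₀ hps₀
  exact ⟨_, hreg, hps, hI⟩

/-! ## The theorem -/

/-- **[KempfEtAl1973] Ch. II §2 Theorem 11* for a linked family of rational fans — PROVED**:
`Fan.LinkedRegularRefinementFamily` holds (simultaneous regular simplicial refinements by
lattice star subdivisions with integral tight strict support data whose minimum functions are
compatible with every link, and cones corresponding under the links). With
`Kato1994_logRegular_hasResolution_general_of_linkedRegularRefinementFamily`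
(`LogRegularResolutionGeneral.lean`) this gives the atlas form of Kato 1994 (10.4).
[cite: KempfEtAl1973, Ch. II §2 Thm. 11*] [cite: Kato1994, (9.8) and (10.4)] -/
theorem linkedRegularRefinementFamily_holds : Fan.LinkedRegularRefinementFamily := by
  intro ι _ n Δ₀ hΔ₀ L
  classical
  obtain ⟨Γ, hreg, hps, l, hΓ, hlat, hsupp, ⟨f, hord, hnn, hcompat⟩, -⟩ := descent_phase Δ₀ hΔ₀ L
  obtain ⟨c, hc, hpack⟩ := family_tight_packaging Δ₀ Γ f hord hnn
  have hΓ' : Γ = fun i => (Δ₀ i).starIter (l i) := funext hΓ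
  subst hΓ'
  refine ⟨l, fun i x => c * f i x, fun i => ⟨hlat i, ?_, hreg i, (hps i).isSimplicial,
    fun x => mul_nonneg hc.le (hnn i x), fun σ hσ => hpack i hσ⟩, fun ℓ hℓ => ?_⟩
  · exact (Δ₀ i).starIter_refines (l i) fun u hu => ⟨hsupp i u hu, (hlat i u hu).2⟩
  · obtain ⟨h1, h2, h3⟩ := hcompat ℓ hℓ
    exact ⟨h1, h2, fun x hx => by show c * f ℓ.j (ℓ.toLin x) = c * f ℓ.i x; rw [h3 x hx]⟩

end Family

end Fan

end Literature.Geometry.PolyhedralFans
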